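import Summits.NavierStokesRegularity.NavierStokesRegularity.Theorems.ScenarioCensusRowF1FrozenKill
import Summits.NavierStokesRegularity.NavierStokesRegularity.Theorems.ScenarioCensusRowF1InviscidTop
import HarnessLib

/-!
# LINE «frozen-top» port, part 5/6: §5 the joint compactness engine of weight 4 (exact Liouville ⇒ ε(M)-Liouville); §6 the transfer — fast points, the quartic clock,
# the weight-4 joint transfer, analytic density (transfer lemmas shared verbatim with the landed columnar / stretched / inviscid ports taken BY NAME)

Re-homed for the scenario census (typer seat ns-census-typer-1 g8; the cells F1fzq ⊇ F1fz are MEMBERS OF RECORD «DECIDED IN KERNEL IN FILES» of row F1 since census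
v1.72 (critic idea-crit-3 g7 PASS — no price 23:50:38Z; ref ns-census-ref g9 PRE-CHECK ✓ §14.21 item 32 (shim probe a49fdeaa); lead-presearch label); this port makes
them TREE-decided): VERBATIM PORT of ns-idea-3 LINE 20 «frozen-top», `pub/ideators/ns-idea-3/lines/frozen-top/line-frozen-top.lean` sha16 edc3c151346cc4e4 (1610 l.,
0 sorry; the critic's / ref's farm runs went through a shim because the line's import `Literature.Analysis.FunctionSpaces.WeakTimeDerivativeClassical` had no
farm build — in this port that import is carried only by the part that uses it, `…FrozenPairing` (`FunctionSpaces.sub_eq_intervalIntegral_of_forall_test` in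
`pairing_eq_of_weakEquilibrium`)), split for the 400-line rule into `ScenarioCensusRowF1Frozen` (§1–§2 with the `C²_loc`
tool) → `…FrozenThird` (`C³_loc`) → `…FrozenPairing` (§4a) → `…FrozenKill` (§4b) → `…FrozenTransfer` (§5–§6) → `…FrozenTop` (§7 + census KEYS).  Lean text VERBATIM in namespace `…Theorems.ScenarioCensus.FrozenTop` (the line's `…Cruxes.ScenarioCensusRowF1.FrozenTopLine`
re-homed); port edits: the WTDC import moved to the one part that needs it, `@[conjecture]` on the residual `FreezeSlack` (≡ `ScenarioCensus.Row_F1`, OPEN), five one-line docstrings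
added (gate lint).

No census VALUE is moved here (row F1 stays OPEN-WITH-LINE; the members become TREE-decided by name); NS regularity is NOT proved; `Row_F1` is untouched
(zero movement, `freezeSlack_iff_rowF1`); no summit statement is proved by this file. Lemmas that restate already-landed tree declarations are taken BY NAME (gate lint `dedup.landed`): `fderiv_smul_stPull_apply` = `InviscidTop.fderiv_smul_stPull_apply`, `fderiv_smul_stPull` = `InviscidTop.fderiv_smul_stPull`, `fderiv_fderiv_smul_stPull` = `InviscidTop.fderiv_fderiv_smul_stPull`, `fderiv_fderiv_zoom` = `InviscidTop.fderiv_fderiv_zoom`, `tendsto_clm_of_tendsto_apply` = `InviscidTop.tendsto_clm_of_tendsto_apply`, `tendsto_fderiv_fderiv_apply_of_bound` = `InviscidTop.tendsto_fderiv_fderiv_apply_of_bound`, `tendsto_fderiv_fderiv_of_bound` = `InviscidTop.tendsto_fderiv_fderiv_of_bound`, `tendsto_fderiv_fderiv_of_typeI_seq_Ioo` = `InviscidTop.tendsto_fderiv_fderiv_of_typeI_seq_Ioo`, `tendsto_fderiv_fderiv_of_isTypeIAncientMild_seq` = `InviscidTop.tendsto_fderiv_fderiv_of_isTypeIAncientMild_seq`,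 `sing_of_not_bounded` = `InviscidTop.sing_of_not_bounded`, `tendsto_physicalTime` = `ColumnarTop.tendsto_physicalTime`, `eventually_fast` = `ColumnarTop.eventually_fast`, `sqrt_timeLag` = `StretchedTop.sqrt_timeLag`, `forall_of_forall_ne_zero` = `StretchedTop.forall_of_forall_ne_zero`.
-/

-- the summit and its single problem share the name `NavierStokesRegularity` (D-0017 nested layout)
set_option linter.dupNamespace false

noncomputable section

open MeasureTheory Set Function Filter TopologicalSpace Metric
open scoped Topology NNReal ENNReal InnerProductSpace RealInnerProductSpace Laplacian

namespace Summit.NavierStokesRegularity.NavierStokesRegularity.Theorems.ScenarioCensus.FrozenTop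

open Literature.Analysis Literature.Analysis.FluidPDE
open Summit.NavierStokesRegularity.NavierStokesRegularity.Theorems

/-! ## §5 The joint compactness engine of weight 4: exact Liouville ⇒ ε(M)-Liouville -/

/-- **COMPACTNESS UPGRADE, weight 4 (the engine).**  Let `R(v, L, H, K) ≥ 0` be a continuous read-out of (value,
gradient, Hessian, third-order datum), homogeneous of weight 4 under the `𝒦`-scaling `(v, L, H, K) ↦ (a v, a² L, a³ H, a⁴ K)`
(so that `s² R(W, ∇W, ∇²W, Σᵢ D³W eᵢ eᵢ)(s, y)` is zoom-invariant).  If the EXACT Liouville theorem «`R ≡ 0 ⇒ W ≡ 0`» holds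
in `𝒦_M`, then ONE `ε = ε(M, R) > 0` works: `s² R ≤ ε` everywhere ⇒ `W ≡ 0`.  Proof: normalise a bad sequence by census
row A2a (`θ = 1/2`) and the zoom, extract a `C³_loc` limit in `𝒦_M` (tree `C¹_loc` extraction + the Hessian and third-order
upgrades of §2): it is nontrivial with `R ≡ 0`. -/
theorem exists_eps_liouville₄ (M : ℝ) {R : E3 → (E3 →L[ℝ] E3) → Hess → (E3 →L[ℝ] E3) → ℝ}
    (hRc : Continuous fun q : E3 × (E3 →L[ℝ] E3) × Hess × (E3 →L[ℝ] E3) => R q.1 q.2.1 q.2.2.1 q.2.2.2)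
    (hR0 : ∀ v L H K, 0 ≤ R v L H K)
    (hRh : ∀ a : ℝ, 0 < a → ∀ v L H K, R (a • v) (a ^ 2 • L) (a ^ 3 • H) (a ^ 4 • K) = a ^ 4 * R v L H K)
    (hL : ∀ W : ℝ → E3 → E3, IsTypeIAncientMild M W →
      (∀ s < (0 : ℝ), ∀ y : E3,
        R (W s y) (fderiv ℝ (W s) y) (fderiv ℝ (fderiv ℝ (W s)) y) (lapD (W s) y) = 0) →
      ∀ s < (0 : ℝ), ∀ y : E3, W s y = 0) :
    ∃ ε : ℝ, 0 < ε ∧ ∀ W : ℝ → E3 → E3, IsTypeIAncientMild M W →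
      (∀ s < (0 : ℝ), ∀ y : E3,
        s ^ 2 * R (W s y) (fderiv ℝ (W s) y) (fderiv ℝ (fderiv ℝ (W s)) y) (lapD (W s) y) ≤ ε) →
      ∀ s < (0 : ℝ), ∀ y : E3, W s y = 0 := by
  by_contra hcon
  have hseq : ∀ n : ℕ, ∃ W : ℝ → E3 → E3, IsTypeIAncientMild M W ∧
      (∀ s < (0 : ℝ), ∀ y : E3,
        s ^ 2 * R (W s y) (fderiv ℝ (W s) y) (fderiv ℝ (fderiv ℝ (W s)) y) (lapD (W s) y) ≤
          1 / ((n : ℝ) + 1)) ∧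
      ∃ s < (0 : ℝ), ∃ y : E3, W s y ≠ 0 := by
    intro n
    by_contra h
    push Not at h
    exact hcon ⟨1 / ((n : ℝ) + 1), by positivity, h⟩
  choose W hW hD hnz using hseq
  -- ## (1) normalisation (census row A2a, `θ = 1/2`)
  have hbig : ∀ n, ∃ t < (0 : ℝ), ∃ x : E3, (1 / 2 : ℝ) / Real.sqrt (-t) < ‖W n t x‖ := by
    intro n
    by_contra hc
    push Not at hc
    have hhalf : IsTypeIAncientMild (1 / 2) (W n) :=
      ⟨(hW n).1, (hW n).2.1, (hW n).2.2.1, fun t ht x => hc t ht x⟩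
    obtain ⟨s, hs, y, hy⟩ := hnz n
    exact hy (ScenarioCensus.row_A2a_excluded (1 / 2) (by norm_num) (W n) hhalf s hs y)
  choose T hT X hX using hbig
  -- ## (2) zoom about `(T n, X n)` by `λ_n = √(-T n)`
  set lam : ℕ → ℝ := fun n => Real.sqrt (-T n) with hlam
  have hlam0 : ∀ n, 0 < lam n := fun n => Real.sqrt_pos.2 (neg_pos.2 (hT n))
  have hlam2 : ∀ n, lam n ^ 2 = -T n := fun n => Real.sq_sqrt (neg_pos.2 (hT n)).le
  set v : ℕ → ℝ → E3 → E3 := fun n => lam n • stPull (lam n ^ 2) (lam n) 0 (X n) (W n) with hv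
  have hvA : ∀ n, IsTypeIAncientMild M (v n) := fun n => isTypeIAncientMild_zoom (hW n) (hlam0 n) (X n)
  have hv_apply : ∀ n (s : ℝ) (y : E3), v n s y = lam n • W n (lam n ^ 2 * s) (X n + lam n • y) :=
    fun n s y => zoom_apply (lam n) (X n) (W n) s y
  have hv_fderiv : ∀ n, ∀ s < (0 : ℝ), ∀ y : E3,
      fderiv ℝ (v n s) y = (lam n ^ 2) • fderiv ℝ (W n (lam n ^ 2 * s)) (X n + lam n • y) := by
    intro n s hs y
    have hs' : lam n ^ 2 * s < 0 := mul_neg_of_pos_of_neg (pow_pos (hlam0 n) 2) hs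
    exact fderiv_zoom (X n) (W n) (((hW n).contDiff_slice hs').differentiable (by simp)) y
  have hv_hess : ∀ n (s : ℝ) (y : E3), fderiv ℝ (fderiv ℝ (v n s)) y =
      (lam n ^ 3) • fderiv ℝ (fderiv ℝ (W n (lam n ^ 2 * s))) (X n + lam n • y) :=
    fun n s y => InviscidTop.fderiv_fderiv_zoom (lam n) (X n) (W n) s y
  have hv_lap : ∀ n (s : ℝ) (y : E3), lapD (v n s) y =
      (lam n ^ 4) • lapD (W n (lam n ^ 2 * s)) (X n + lam n • y) :=
    fun n s y => lapD_zoom (lam n) (X n) (W n) s y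
  have hv_big : ∀ n, (1 / 2 : ℝ) < ‖v n (-1) 0‖ := by
    intro n
    rw [hv_apply, smul_zero, add_zero, mul_neg_one, hlam2, neg_neg, norm_smul, Real.norm_eq_abs,
      abs_of_pos (hlam0 n)]
    have h := hX n
    rw [div_lt_iff₀ (hlam0 n)] at h
    linarith [mul_comm (lam n) ‖W n (T n) (X n)‖]
  have hv_def : ∀ n, ∀ s < (0 : ℝ), ∀ y : E3,
      s ^ 2 * R (v n s y) (fderiv ℝ (v n s) y) (fderiv ℝ (fderiv ℝ (v n s)) y) (lapD (v n s) y) ≤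
        1 / ((n : ℝ) + 1) := by
    intro n s hs y
    have hs' : lam n ^ 2 * s < 0 := mul_neg_of_pos_of_neg (pow_pos (hlam0 n) 2) hs
    have key : ∀ Xr : ℝ, s ^ 2 * (lam n ^ 4 * Xr) = (lam n ^ 2 * s) ^ 2 * Xr := by
      intro Xr
      ring
    rw [hv_apply, hv_fderiv n s hs, hv_hess, hv_lap, hRh _ (hlam0 n), key]
    exact hD n _ hs' _
  -- ## (3) the `C³_loc` extraction in `𝒦_M`
  obtain ⟨φ, hφ, U, hU, hconv, hgrad, -, -⟩ := exists_tendsto_of_isTypeIAncientMild_seq M hvA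
  have hhess := InviscidTop.tendsto_fderiv_fderiv_of_isTypeIAncientMild_seq (v := fun j => v (φ j))
    (fun j => hvA (φ j)) hU hgrad
  have hlap := tendsto_lapD_of_isTypeIAncientMild_seq (v := fun j => v (φ j))
    (fun j => hvA (φ j)) hU hgrad
  have hφt : Tendsto φ atTop atTop := hφ.tendsto_atTop
  have hDU : ∀ s < (0 : ℝ), ∀ y : E3,
      R (U s y) (fderiv ℝ (U s) y) (fderiv ℝ (fderiv ℝ (U s)) y) (lapD (U s) y) = 0 := by
    intro s hs y
    have hj := (hconv s hs y).prodMk_nhds ((hgrad s hs y).prodMk_nhds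
      ((hhess s hs y).prodMk_nhds (hlap s hs y)))
    have hlimD : Tendsto (fun j => s ^ 2 *
        R (v (φ j) s y) (fderiv ℝ (v (φ j) s) y) (fderiv ℝ (fderiv ℝ (v (φ j) s)) y) (lapD (v (φ j) s) y))
        atTop (𝓝 (s ^ 2 * R (U s y) (fderiv ℝ (U s) y) (fderiv ℝ (fderiv ℝ (U s)) y) (lapD (U s) y))) :=
      ((hRc.tendsto _).comp hj).const_mul _
    have hzero : Tendsto (fun j => 1 / ((φ j : ℝ) + 1)) atTop (𝓝 0) :=
      tendsto_one_div_add_atTop_nhds_zero_nat.comp hφt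
    have hle : s ^ 2 * R (U s y) (fderiv ℝ (U s) y) (fderiv ℝ (fderiv ℝ (U s)) y) (lapD (U s) y) ≤ 0 :=
      le_of_tendsto_of_tendsto hlimD hzero (Eventually.of_forall fun j => hv_def (φ j) s hs y)
    have hw : 0 < s ^ 2 := by rw [sq]; exact mul_pos_of_neg_of_neg hs hs
    have hn : R (U s y) (fderiv ℝ (U s) y) (fderiv ℝ (fderiv ℝ (U s)) y) (lapD (U s) y) ≤ 0 := by
      by_contra hpos
      push Not at hpos
      exact absurd hle (not_le.2 (mul_pos hw hpos))
    exact le_antisymm hn (hR0 _ _ _ _)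
  have hUbig : (1 / 2 : ℝ) ≤ ‖U (-1) 0‖ :=
    ge_of_tendsto ((hconv (-1) (by norm_num) 0).norm) (Eventually.of_forall fun j => (hv_big (φ j)).le)
  have hU0 : U (-1) 0 = 0 := hL U hU hDU (-1) (by norm_num) 0
  rw [hU0, norm_zero] at hUbig
  linarith

/-- **ε-LIOUVILLE, almost-steady vorticity** (new A-row, in kernel): ∀ M ∃ ε(M) > 0: `W ∈ 𝒦_M` with
`s² ‖Δω − (W·∇)ω + (ω·∇)W‖ ≤ ε` everywhere (`ω = curl W`) ⇒ `W ≡ 0`. -/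
theorem exists_eps_liouville_transport (M : ℝ) : ∃ ε : ℝ, 0 < ε ∧ ∀ W : ℝ → E3 → E3,
    IsTypeIAncientMild M W →
    (∀ s < (0 : ℝ), ∀ y : E3, s ^ 2 *
      ‖(Δ (curl (W s))) y - convect (W s) (curl (W s)) y + convect (curl (W s)) (W s) y‖ ≤ ε) →
    ∀ s < (0 : ℝ), ∀ y : E3, W s y = 0 := by
  obtain ⟨ε, hε, h⟩ := exists_eps_liouville₄ M (R := fun v L H K => ‖vortOf v L H K‖) continuous_vortOf.norm
    (fun v L H K => norm_nonneg _) (fun a ha v L H K => by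
      show ‖vortOf (a • v) (a ^ 2 • L) (a ^ 3 • H) (a ^ 4 • K)‖ = a ^ 4 * ‖vortOf v L H K‖
      rw [vortOf_smul, norm_smul, Real.norm_eq_abs, abs_of_pos (pow_pos ha 4)])
    (fun W hW h0 => eq_zero_of_vorticitySteady hW fun s hs y => by
      rw [transport_eq_vortOf ((hW.contDiff_slice hs).of_le (by norm_cast))]
      exact norm_eq_zero.1 (h0 s hs y))
  exact ⟨ε, hε, fun W hW hb => h W hW fun s hs y => by
    rw [← transport_eq_vortOf ((hW.contDiff_slice hs).of_le (by norm_cast))]; exact hb s hs y⟩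

/-! ## §6 The transfer: fast points, the quartic clock, the weight-4 joint transfer, analytic density -/

-- `tendsto_physicalTime`: the line restates the tree's `ColumnarTop.tendsto_physicalTime`; taken BY NAME (gate lint dedup.landed).

-- `sqrt_timeLag`: the line restates the tree's `StretchedTop.sqrt_timeLag`; taken BY NAME (gate lint dedup.landed).

-- `eventually_fast`: the line restates the tree's `ColumnarTop.eventually_fast`; taken BY NAME (gate lint dedup.landed).

/-- `R = ν α` under the `M`-normalisation `α R = β`, `α √ν = √β`. -/
theorem radius_eq {ν α β R : ℝ} (hν : 0 < ν) (hα : 0 < α) (hβ : 0 < β) (hαR : α * R = β)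
    (hαν : α * Real.sqrt ν = Real.sqrt β) : R = ν * α := by
  have h1 : α * (ν * α) = α * R := by
    calc α * (ν * α) = (α * Real.sqrt ν) * (α * Real.sqrt ν) := by
          have := Real.mul_self_sqrt hν.le
          calc α * (ν * α) = α * α * ν := by ring
            _ = α * α * (Real.sqrt ν * Real.sqrt ν) := by rw [this]
            _ = (α * Real.sqrt ν) * (α * Real.sqrt ν) := by ring
      _ = Real.sqrt β * Real.sqrt β := by rw [hαν]
      _ = β := Real.mul_self_sqrt hβ.le
      _ = α * R := hαR.symm
  exact (mul_left_cancel₀ hα.ne' h1).symm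

/-- **The quartic clock identity**: `(c R)⁴ t² = (ν (T − τ_j))²` under the `M`-normalisation (`R² = ν β`): the
weight-4 zoom weight `s²` is exactly the pressure-free, viscosity-free physical weight `(T − t)²` (times `ν²` from the
`ν`-normalisation of the four arguments). -/
theorem quart_clock_eq {T ν t α β R : ℝ} (hν : 0 < ν) (hα : 0 < α) (hβ : 0 < β) (hαR : α * R = β)
    (hαν : α * Real.sqrt ν = Real.sqrt β) {c : ℕ → ℝ} (j : ℕ) :
    (c j * R) ^ 4 * t ^ 2 = (ν * (T - (T + c j ^ 2 * β * t))) ^ 2 := by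
  have hR := radius_eq hν hα hβ hαR hαν
  have hβ' : β = ν * α ^ 2 := by rw [← hαR, hR]; ring
  rw [hR, hβ']
  ring

/-- **JOINT TRANSFER, weight 4**: for a continuous read-out `Rd(v, L, H, K)`, homogeneous of weight 4 under
`(a, a², a³, a⁴)`, the physical bound «`(ν (T − t'))² Rd(u/ν, ∇u/ν, ∇²u/ν, K/ν) ≤ ε` at the `Λ t'`-fast points,
eventually» passes to «`t² Rd(W, ∇W, ∇²W, Σᵢ D³W eᵢ eᵢ)(t, y) ≤ ε` at every `y` with `W(t, y) ≠ 0`». -/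
theorem joint_transfer₄ {T ν ε : ℝ} {u : ℝ → E3 → E3} {x₀ : E3} {α β R : ℝ} {c : ℕ → ℝ}
    {W : ℝ → E3 → E3} (hν : 0 < ν)
    (hα : 0 < α) (hβ : 0 < β) (hαR : α * R = β) (hαν : α * Real.sqrt ν = Real.sqrt β)
    (hcpos : ∀ j, 0 < c j) (hclim : Tendsto c atTop (𝓝 0))
    (hpt : ∀ t < 0, ∀ y : E3,
      Tendsto (fun j => (c j * α) • u (T + c j ^ 2 * β * t) (x₀ + (c j * R) • y)) atTop (𝓝 (W t y)))
    (hgrad : ∀ t < 0, ∀ y : E3,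
      Tendsto (fun j => (c j * α * (c j * R)) • fderiv ℝ (u (T + c j ^ 2 * β * t)) (x₀ + (c j * R) • y))
        atTop (𝓝 (fderiv ℝ (W t) y)))
    (hhess : ∀ t < 0, ∀ y : E3,
      Tendsto (fun j => (c j * α * (c j * R) * (c j * R)) •
          fderiv ℝ (fderiv ℝ (u (T + c j ^ 2 * β * t))) (x₀ + (c j * R) • y))
        atTop (𝓝 (fderiv ℝ (fderiv ℝ (W t)) y)))
    (hlap : ∀ t < 0, ∀ y : E3,
      Tendsto (fun j => (c j * α * (c j * R) * (c j * R) * (c j * R)) •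
          lapD (u (T + c j ^ 2 * β * t)) (x₀ + (c j * R) • y))
        atTop (𝓝 (lapD (W t) y)))
    {Rd : E3 → (E3 →L[ℝ] E3) → Hess → (E3 →L[ℝ] E3) → ℝ}
    (hRc : Continuous fun q : E3 × (E3 →L[ℝ] E3) × Hess × (E3 →L[ℝ] E3) => Rd q.1 q.2.1 q.2.2.1 q.2.2.2)
    (hRh : ∀ a : ℝ, 0 < a → ∀ v L H K, Rd (a • v) (a ^ 2 • L) (a ^ 3 • H) (a ^ 4 • K) = a ^ 4 * Rd v L H K)
    {Λ : ℝ → ℝ} (hΛ : IsSubcriticalLevel T Λ) (hH : HasJointDefect₄At T Λ ν ε Rd u) :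
    ∀ t < 0, ∀ y, W t y ≠ 0 →
      t ^ 2 * Rd (W t y) (fderiv ℝ (W t) y) (fderiv ℝ (fderiv ℝ (W t)) y) (lapD (W t) y) ≤ ε := by
  intro t ht y hne
  have hj := (hpt t ht y).prodMk_nhds ((hgrad t ht y).prodMk_nhds ((hhess t ht y).prodMk_nhds (hlap t ht y)))
  have hlim := ((hRc.tendsto _).comp hj).const_mul (t ^ 2)
  have hfast := ColumnarTop.eventually_fast hα hβ hcpos hclim hpt hΛ ht hne
  have hτ := ColumnarTop.tendsto_physicalTime (T := T) hβ ht hcpos hclim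
  have hR := radius_eq hν hα hβ hαR hαν
  refine le_of_tendsto hlim ?_
  filter_upwards [hfast, hτ.eventually hH] with j hj1 hj2
  have hb := hj2 _ hj1
  have ha : 0 < c j * R := by rw [hR]; exact mul_pos (hcpos j) (mul_pos hν hα)
  -- the zoom quadruple is `(a • u/ν, a² • ∇u/ν, a³ • ∇²u/ν, a⁴ • K/ν)` with `a = c_j R`
  have e1 : c j * α = (c j * R) * ν⁻¹ := by rw [hR]; field_simp
  have e2 : c j * α * (c j * R) = (c j * R) ^ 2 * ν⁻¹ := by rw [hR]; field_simp
  have e3 : c j * α * (c j * R) * (c j * R) = (c j * R) ^ 3 * ν⁻¹ := by rw [hR]; field_simp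
  have e4 : c j * α * (c j * R) * (c j * R) * (c j * R) = (c j * R) ^ 4 * ν⁻¹ := by rw [hR]; field_simp
  show t ^ 2 *
      Rd ((c j * α) • u (T + c j ^ 2 * β * t) (x₀ + (c j * R) • y))
        ((c j * α * (c j * R)) • fderiv ℝ (u (T + c j ^ 2 * β * t)) (x₀ + (c j * R) • y))
        ((c j * α * (c j * R) * (c j * R)) •
          fderiv ℝ (fderiv ℝ (u (T + c j ^ 2 * β * t))) (x₀ + (c j * R) • y))
        ((c j * α * (c j * R) * (c j * R) * (c j * R)) •
          lapD (u (T + c j ^ 2 * β * t)) (x₀ + (c j * R) • y)) ≤ ε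
  rw [e4, e3, e2, e1, mul_smul (c j * R) ν⁻¹, mul_smul ((c j * R) ^ 2) ν⁻¹, mul_smul ((c j * R) ^ 3) ν⁻¹,
    mul_smul ((c j * R) ^ 4) ν⁻¹, hRh _ ha, ← mul_assoc, mul_comm (t ^ 2),
    quart_clock_eq (T := T) (t := t) hν hα hβ hαR hαν j]
  exact hb

-- `forall_of_forall_ne_zero`: the line restates the tree's `StretchedTop.forall_of_forall_ne_zero`; taken BY NAME (gate lint dedup.landed).

/-- The third-order datum of an identically vanishing slice vanishes. -/
theorem lapD_eq_zero_of_eq_zero {v : E3 → E3} (h0 : ∀ z, v z = 0) (y : E3) : lapD v y = 0 := by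
  have h0' : v = fun _ => (0 : E3) := funext h0
  have h1 : fderiv ℝ v = fun _ => (0 : E3 →L[ℝ] E3) := by
    funext z; rw [h0', fderiv_const_apply]
  have h2 : fderiv ℝ (fderiv ℝ v) = fun _ => (0 : Hess) := by
    funext z; rw [h1, fderiv_const_apply]
  have h3 : fderiv ℝ (fderiv ℝ (fderiv ℝ v)) y = 0 := by rw [h2, fderiv_const_apply]
  simp [lapD, h3]

/-- **Joint conditions globalise (weight 4)**: a closed condition on `(W, ∇W, ∇²W, Σᵢ D³W eᵢ eᵢ)(s, ·)` holding on
`{W(s, ·) ≠ 0}` and at `(0, 0, 0, 0)` holds everywhere (analytic density on nontrivial slices). -/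
theorem jointCond_everywhere₄ {C : ℝ} {W : ℝ → E3 → E3} (hW : IsTypeIAncientMild C W)
    {P : ℝ → E3 × (E3 →L[ℝ] E3) × Hess × (E3 →L[ℝ] E3) → Prop} (hPc : ∀ w : ℝ, IsClosed {q | P w q})
    (hP0 : ∀ w : ℝ, P w (0, 0, 0, 0))
    (h : ∀ s < 0, ∀ y, W s y ≠ 0 →
      P s (W s y, fderiv ℝ (W s) y, fderiv ℝ (fderiv ℝ (W s)) y, lapD (W s) y)) :
    ∀ s < 0, ∀ y, P s (W s y, fderiv ℝ (W s) y, fderiv ℝ (fderiv ℝ (W s)) y, lapD (W s) y) := by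
  intro s hs y
  by_cases hnt : ∃ z, W s z ≠ 0
  · have hsm := hW.contDiff_slice hs
    have hc0 : Continuous (W s) := hW.continuous_slice hs
    have hc1 : Continuous fun y => fderiv ℝ (W s) y := hsm.continuous_fderiv (by simp)
    have hd2 : ContDiff ℝ 2 (fderiv ℝ (W s)) := (hsm.of_le (by norm_cast : ((3 : ℕ) : WithTop ℕ∞) ≤ _)).fderiv_right
      (by norm_cast)
    have hc2 : Continuous fun y => fderiv ℝ (fderiv ℝ (W s)) y := hd2.continuous_fderiv (by norm_num)
    have hd3 : ContDiff ℝ 1 (fderiv ℝ (fderiv ℝ (W s))) := hd2.fderiv_right (by norm_cast)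
    -- continuity of `y ↦ Σᵢ D³W(s, y) eᵢ eᵢ` WITHOUT a topology on the space of third derivatives:
    -- `D³W(y) eᵢ eᵢ = D(z ↦ D²W(z) eᵢ)(y) eᵢ`
    have hcl : Continuous fun y => lapD (W s) y := by
      unfold lapD
      refine continuous_finsetSum _ fun i _ => ?_
      have hci : ContDiff ℝ 1 (fun z => fderiv ℝ (fderiv ℝ (W s)) z (eI i)) := hd3.clm_apply contDiff_const
      have hdi : ∀ y, fderiv ℝ (fun z => fderiv ℝ (fderiv ℝ (W s)) z (eI i)) y (eI i) =
          fderiv ℝ (fderiv ℝ (fderiv ℝ (W s))) y (eI i) (eI i) := by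
        intro y
        rw [fderiv_clm_apply (hd3.differentiable (by simp) y) (differentiableAt_const _)]
        simp
      have hfun : (fun y => fderiv ℝ (fderiv ℝ (fderiv ℝ (W s))) y (eI i) (eI i)) =
          fun y => fderiv ℝ (fun z => fderiv ℝ (fderiv ℝ (W s)) z (eI i)) y (eI i) :=
        funext fun y => (hdi y).symm
      rw [hfun]
      exact (hci.continuous_fderiv (by simp)).clm_apply continuous_const
    have hS : IsClosed {y : E3 | P s (W s y, fderiv ℝ (W s) y, fderiv ℝ (fderiv ℝ (W s)) y, lapD (W s) y)} :=
      (hPc s).preimage (hc0.prodMk (hc1.prodMk (hc2.prodMk hcl)))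
    exact StretchedTop.forall_of_forall_ne_zero hW hs hS (fun y hy => h s hs y hy) hnt y
  · push Not at hnt
    have h0 : W s = fun _ => (0 : E3) := funext hnt
    have h1 : fderiv ℝ (W s) = fun _ => (0 : E3 →L[ℝ] E3) := by
      funext z; rw [h0, fderiv_const_apply]
    have h2 : fderiv ℝ (fderiv ℝ (W s)) y = 0 := by rw [h1, fderiv_const_apply]
    rw [lapD_eq_zero_of_eq_zero hnt, h2, h1, hnt y]
    exact hP0 s

/-- **The full joint transfer (weight 4)**: an ε-joint-defect of a nonnegative, weight-4 homogeneous, continuous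
read-out on the top passes to `s² Rd(W, ∇W, ∇²W, Σᵢ D³W eᵢ eᵢ)(s, y) ≤ ε` at EVERY point of the open past of the limit. -/
theorem joint_transfer_everywhere₄ {T ν ε M : ℝ} {u : ℝ → E3 → E3} {x₀ : E3} {α β R : ℝ} {c : ℕ → ℝ}
    {W : ℝ → E3 → E3} (hW : IsTypeIAncientMild M W) (hν : 0 < ν)
    (hα : 0 < α) (hβ : 0 < β) (hαR : α * R = β) (hαν : α * Real.sqrt ν = Real.sqrt β)
    (hcpos : ∀ j, 0 < c j) (hclim : Tendsto c atTop (𝓝 0))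
    (hpt : ∀ t < 0, ∀ y : E3,
      Tendsto (fun j => (c j * α) • u (T + c j ^ 2 * β * t) (x₀ + (c j * R) • y)) atTop (𝓝 (W t y)))
    (hgrad : ∀ t < 0, ∀ y : E3,
      Tendsto (fun j => (c j * α * (c j * R)) • fderiv ℝ (u (T + c j ^ 2 * β * t)) (x₀ + (c j * R) • y))
        atTop (𝓝 (fderiv ℝ (W t) y)))
    (hhess : ∀ t < 0, ∀ y : E3,
      Tendsto (fun j => (c j * α * (c j * R) * (c j * R)) •
          fderiv ℝ (fderiv ℝ (u (T + c j ^ 2 * β * t))) (x₀ + (c j * R) • y))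
        atTop (𝓝 (fderiv ℝ (fderiv ℝ (W t)) y)))
    (hlap : ∀ t < 0, ∀ y : E3,
      Tendsto (fun j => (c j * α * (c j * R) * (c j * R) * (c j * R)) •
          lapD (u (T + c j ^ 2 * β * t)) (x₀ + (c j * R) • y))
        atTop (𝓝 (lapD (W t) y)))
    {Rd : E3 → (E3 →L[ℝ] E3) → Hess → (E3 →L[ℝ] E3) → ℝ}
    (hRc : Continuous fun q : E3 × (E3 →L[ℝ] E3) × Hess × (E3 →L[ℝ] E3) => Rd q.1 q.2.1 q.2.2.1 q.2.2.2)
    (hRh : ∀ a : ℝ, 0 < a → ∀ v L H K, Rd (a • v) (a ^ 2 • L) (a ^ 3 • H) (a ^ 4 • K) = a ^ 4 * Rd v L H K)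
    (hR0 : Rd 0 0 0 0 = 0) (hε : 0 ≤ ε) {Λ : ℝ → ℝ} (hΛ : IsSubcriticalLevel T Λ)
    (hH : HasJointDefect₄At T Λ ν ε Rd u) :
    ∀ s < 0, ∀ y,
      s ^ 2 * Rd (W s y) (fderiv ℝ (W s) y) (fderiv ℝ (fderiv ℝ (W s)) y) (lapD (W s) y) ≤ ε := by
  have hPc : ∀ w : ℝ,
      IsClosed {q : E3 × (E3 →L[ℝ] E3) × Hess × (E3 →L[ℝ] E3) | w ^ 2 * Rd q.1 q.2.1 q.2.2.1 q.2.2.2 ≤ ε} :=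
    fun w => isClosed_le (continuous_const.mul hRc) continuous_const
  exact jointCond_everywhere₄ hW (P := fun w q => w ^ 2 * Rd q.1 q.2.1 q.2.2.1 q.2.2.2 ≤ ε) hPc
    (fun w => by show w ^ 2 * Rd 0 0 0 0 ≤ ε; rw [hR0, mul_zero]; exact hε)
    (joint_transfer₄ hν hα hβ hαR hαν hcpos hclim hpt hgrad hhess hlap hRc hRh hΛ hH)

end Summit.NavierStokesRegularity.NavierStokesRegularity.Theorems.ScenarioCensus.FrozenTop

end
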